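import Mathlib
import HarnessLib

/-!
# Route `DepthWindow` — the universal golden-ratio cap of the threshold-law template (lens 4, generation 12)

Helper file of the route `Theses/DepthWindow.lean` (decomp-valiant workshop, lens 4 «depth-reduction / chasm axis»,
generation 12; cone-free, `--supports` the open A-cell `HomImmHardTwoOne`).  It proves a BARRIER THEOREM for the
one lower-bound engine the dial has in the tree — the flat, law-driven relative-rank induction
`Law.relRank_eval_le_law` (`DepthWindowGenFlatRank.lean`; [LimayeSrinivasanTavenas2025, Claim 16] /
[BhargavDuttaSaxena2024, Lemma 4.3]) — UNIFORMLY IN THE WORD: any length `d`, any alphabet, any real weights.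

**The template.**  The engine is run with a signed word `w` (weights `wt i = ± sz i`), real thresholds `θ_p > 1`,
law constants `κ_p` with `#W · κ_p ≤ |w_W|` for every block set `W` with `#W < θ_p` (`p < Δ`), the step
`2^{-κ_p θ_{p+1}/2} ≤ ε` (`p < Δ`) and the fit `θ_Δ ≤ d`; it returns `relrk(C) ≤ (s·d^d + 1)^Δ · ε`.  The word must be
a restriction of `IMM_{n,d}`, which forces the prefix bound `2^{|w_{[t]}|} ≤ n` (`GenWord.wordSubst`).

**The cap (new; the two-letter case is [BhargavDuttaSaxena2024, Claim 5.4]).**  `LawCap.fib_cap`: if all prefix sums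
of a real word are bounded by `M` and every level certifies `κ_p θ_{p+1} ≥ e > 4M`, then
`4^{F_Δ} · (e/4M)^{2F_Δ - 1} ≤ d` (`F` = Fibonacci).  The proof replaces Dirichlet's theorem in BDS's two-letter
argument by the prefix-sum pigeonhole (`exists_light_window`: among any `n+1` consecutive prefix sums two are
`2M/n`-close, so some window of `≤ n` letters has `|w_W| ≤ 2M/n` — the ordered-word form of the generalized Dirichlet
principle [LimayeSrinivasanTavenas2022, Lemma 9]), which holds for EVERY word; the two-scale step
(`a light window at scale θ_{p+1}` is either shorter than `θ_p` — contradicting level `p` — or at least `θ_p` long, whence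
`θ_{p+2} ≥ (e/4M) θ_{p+1} θ_p`) gives Fibonacci growth of `log θ_p`.

**Consequences (this file).**  `exists_weak_level` / `eps_ge`: once `d < 4^{F_Δ}` some level has `κ_p θ_{p+1} ≤ 4M`,
so the engine can only be invoked with `ε ≥ 2^{-2M}`.  The companion file `DepthWindowLawCapCell.lean` restates this
over the engine's literal hypotheses (`GenWord.wsum`, `GenWord.overLen`, `M = ⌊log₂ n⌋ + 1`) and shows that the open cell
`HomImmHardTwoOne` (`d = ⌊√⌊log₂ m⌋⌋`, `Δ = 2·L₃(m) + c`, any `c`, all `m ≥ 16`) lies in the regime `d < 4^{F_Δ}`: EVERY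
instance of the threshold-law template there has `ε ≥ (2n)^{-2}`, i.e. (against `relrk(P_w) ≥ n^{-1/2}`) certifies at most
`(s d^d+1)^Δ ≥ 4 n^{3/2}`, a polynomial bound — never `size > m^c` for all `c`.  The same holds at every dial slope
`σ > 1/log₂ φ ≈ 1.4404` (`F_{σ L₃} ≫ log d`), while [BhargavDuttaSaxena2024, Thm 1.2] attains every `σ < 1/log₂ φ` (in the
tree: `homImmHardAt_of_le_36_25`, `σ ≤ 36/25`): the threshold-law method is capped exactly at the golden-ratio slope, for
all alphabets.  What the cap does NOT touch: lower bounds for the measure `relrk_w` that exploit more than a per-block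
imbalance law (the tree-bias characterisation [LimayeSrinivasanTavenas2022, Thm 3], for words whose light blocks do not
tile), and other measures.

Unconditional, 0 sorry, standard axioms; rung/barrier currency only — nothing here bears on `VP ≠ VNP` itself.

References: [BhargavDuttaSaxena2024] §5.2 Claim 5.4 (two weights, via Dirichlet's approximation theorem);
[LimayeSrinivasanTavenas2025] Claim 16, Lemma 15; [LimayeSrinivasanTavenas2022] Lemma 9 (the generalized Dirichlet
principle: light sub-multisets exist in every multiset), Thm 3, Thm 5.
-/

-- layout Summits/ValiantsHypothesis/ValiantsHypothesis forces the duplicated namespace component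
set_option linter.dupNamespace false

namespace Summit.ValiantsHypothesis.ValiantsHypothesis.Theorems.DepthWindow.LawCap

open Finset

/-! ### The prefix-sum pigeonhole (any real word) -/

/-- Among `n + 1` reals in `[-M, M]` (`n ≥ 1`) two are `2M/n`-close. -/
theorem exists_close_pair {M : ℝ} (hM : 0 < M) {n : ℕ} (hn : 1 ≤ n) (S : Fin (n + 1) → ℝ)
    (hS : ∀ j, |S j| ≤ M) : ∃ i j : Fin (n + 1), i < j ∧ |S j - S i| ≤ 2 * M / n := by
  have hn0 : (0 : ℝ) < n := by exact_mod_cast hn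
  set x : Fin (n + 1) → ℝ := fun j => (S j + M) / (2 * M) * n with hx
  have hx0 : ∀ j, 0 ≤ x j := fun j => by
    have h := (abs_le.1 (hS j)).1
    exact mul_nonneg (div_nonneg (by linarith) (by linarith)) hn0.le
  have hxn : ∀ j, x j ≤ n := fun j => by
    have h := (abs_le.1 (hS j)).2
    have h1 : (S j + M) / (2 * M) ≤ 1 := by rw [div_le_one (by linarith)]; linarith
    have : (S j + M) / (2 * M) * n ≤ 1 * n := mul_le_mul_of_nonneg_right h1 hn0.le
    simpa using this
  let bucket : Fin (n + 1) → Fin n := fun j => ⟨min ⌊x j⌋₊ (n - 1), by omega⟩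
  obtain ⟨i, j, hij, hb⟩ := Fintype.exists_ne_map_eq_of_card_lt bucket (by simp)
  have hb' : min ⌊x i⌋₊ (n - 1) = min ⌊x j⌋₊ (n - 1) := by
    have := congrArg Fin.val hb
    simpa [bucket] using this
  have hn1 : ((n - 1 : ℕ) : ℝ) = n - 1 := by rw [Nat.cast_sub hn, Nat.cast_one]
  have key : ∀ i j, min ⌊x i⌋₊ (n - 1) = min ⌊x j⌋₊ (n - 1) → x i - x j ≤ 1 := by
    intro i j h
    have hfi := Nat.floor_le (hx0 i)
    have hfi' := Nat.lt_floor_add_one (x i)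
    have hfj := Nat.floor_le (hx0 j)
    have hfj' := Nat.lt_floor_add_one (x j)
    by_cases hbj : ⌊x j⌋₊ ≤ n - 1
    · rw [min_eq_left hbj] at h
      by_cases hai : ⌊x i⌋₊ ≤ n - 1
      · rw [min_eq_left hai] at h
        have : (⌊x i⌋₊ : ℝ) = ⌊x j⌋₊ := by exact_mod_cast h
        linarith
      · rw [min_eq_right (le_of_not_ge hai)] at h
        have : ((n - 1 : ℕ) : ℝ) = ⌊x j⌋₊ := by exact_mod_cast h
        linarith [hxn i]
    · push Not at hbj
      have h1 : n ≤ ⌊x j⌋₊ := by omega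
      have : (n : ℝ) ≤ ⌊x j⌋₊ := by exact_mod_cast h1
      linarith [hxn i]
  have h1 := key i j hb'
  have h2 := key j i hb'.symm
  have hdiff : |x j - x i| ≤ 1 := abs_le.2 ⟨by linarith, by linarith⟩
  have hSx : S j - S i = (x j - x i) * (2 * M / n) := by
    simp only [hx]
    field_simp
    ring
  have hclose : |S j - S i| ≤ 2 * M / n := by
    have hpos : 0 < 2 * M / n := div_pos (by linarith) hn0
    rw [hSx, abs_mul, abs_of_pos hpos]
    calc |x j - x i| * (2 * M / n) ≤ 1 * (2 * M / n) := mul_le_mul_of_nonneg_right hdiff hpos.le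
      _ = 2 * M / n := one_mul _
  rcases lt_or_gt_of_ne hij with h | h
  · exact ⟨i, j, h, hclose⟩
  · refine ⟨j, i, h, ?_⟩
    rwa [abs_sub_comm]

/-- **Light windows exist in every word.**  If all prefix sums `∑_{m<j} f m` (`j ≤ d`) lie in `[-M, M]`, then for
every `1 ≤ n ≤ d` some window `W = [i, j)` of `1 ≤ #W ≤ n` letters has `|∑_W f| ≤ 2M/n`
(the ordered-word form of [LimayeSrinivasanTavenas2022, Lemma 9]). -/
theorem exists_light_window (f : ℕ → ℝ) {d : ℕ} {M : ℝ} (hM : 0 < M)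
    (hpre : ∀ j, j ≤ d → |∑ m ∈ range j, f m| ≤ M) {n : ℕ} (hn : 1 ≤ n) (hnd : n ≤ d) :
    ∃ W : Finset ℕ, W ⊆ range d ∧ 1 ≤ W.card ∧ W.card ≤ n ∧ |∑ m ∈ W, f m| ≤ 2 * M / n := by
  obtain ⟨i, j, hij, hclose⟩ := exists_close_pair hM hn (fun j : Fin (n + 1) => ∑ m ∈ range (j : ℕ), f m)
    (fun j => hpre j (by have := j.isLt; omega))
  have hi := i.isLt
  have hj := j.isLt
  have hij' : (i : ℕ) < j := Fin.lt_def.1 hij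
  refine ⟨Ico (i : ℕ) j, ?_, ?_, ?_, ?_⟩
  · intro m hm
    rw [mem_Ico] at hm
    rw [mem_range]
    omega
  · rw [Nat.card_Ico]; omega
  · rw [Nat.card_Ico]; omega
  · rw [sum_Ico_eq_sub _ hij'.le]
    exact hclose

/-! ### The universal Fibonacci cap -/

/-- **The golden-ratio cap of the threshold-law template, for every word.**  Let `f` be a real word of length `d`
with all prefix sums in `[-M, M]` (`M > 0`), `θ_p > 1` thresholds, `κ_p` law constants with `#W κ_p ≤ |∑_W f|` for all
`W ⊆ [0,d)` with `#W < θ_p` (`p < Δ`), and suppose every level certifies `e ≤ κ_p θ_{p+1}` with `e > 4M`, `Δ ≥ 1` and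
the fit `θ_Δ ≤ d`.  Then `4^{F_Δ} (e/4M)^{2F_Δ-1} ≤ d`.  (New for general words; for two letters this is the
exponential decline of the fractional cost, [BhargavDuttaSaxena2024, Claim 5.4].) -/
theorem fib_cap (f : ℕ → ℝ) {d Δ : ℕ} {M e : ℝ} {θ κ : ℕ → ℝ} (hM : 0 < M)
    (hpre : ∀ j, j ≤ d → |∑ m ∈ range j, f m| ≤ M)
    (hθ1 : ∀ p, 1 < θ p)
    (hlaw : ∀ p, p < Δ → ∀ W : Finset ℕ, W ⊆ range d → (W.card : ℝ) < θ p →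
      (W.card : ℝ) * κ p ≤ |∑ m ∈ W, f m|)
    (he : ∀ p, p < Δ → e ≤ κ p * θ (p + 1)) (heM : 4 * M < e) (hΔ : 1 ≤ Δ)
    (hfit : θ Δ ≤ d) :
    (4 : ℝ) ^ Nat.fib Δ * (e / (4 * M)) ^ (2 * Nat.fib Δ - 1) ≤ d := by
  have hd1 : (1 : ℝ) < d := (hθ1 Δ).trans_le hfit
  have hd : 1 ≤ d := by exact_mod_cast hd1.le
  have hd0 : (0 : ℝ) < d := by linarith
  have he0 : 0 < e := by linarith
  set r : ℝ := e / (4 * M) with hr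
  have hr1 : 1 < r := by rw [hr, lt_div_iff₀ (by linarith)]; linarith
  have hr0 : 0 < r := by linarith
  have hθ0 : ∀ p, 0 < θ p := fun p => by linarith [hθ1 p]
  -- Step B: every threshold above level 0 is at least `e/M = 4r` (singleton law).
  have hB : ∀ p, p < Δ → 4 * r ≤ θ (p + 1) := by
    intro p hp
    have h1 := hlaw p hp {0} (singleton_subset_iff.2 (mem_range.2 (by omega)))
      (by rw [card_singleton, Nat.cast_one]; exact hθ1 p)
    rw [card_singleton, Nat.cast_one, one_mul, sum_singleton] at h1
    have h0 : |f 0| ≤ M := by simpa using hpre 1 hd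
    have h2 := he p hp
    have h3 : e ≤ M * θ (p + 1) :=
      h2.trans (mul_le_mul_of_nonneg_right (h1.trans h0) (hθ0 _).le)
    have h4 : 4 * r = e / M := by rw [hr]; ring
    rw [h4, div_le_iff₀ hM]
    nlinarith [h3]
  -- Step A: no threshold up to level Δ exceeds `d + 1`.
  have hA : ∀ p, p ≤ Δ → θ p ≤ d + 1 := by
    by_contra hcon
    push Not at hcon
    obtain ⟨p, hpΔ, hp⟩ := hcon
    have key : ∀ q, p ≤ q → q ≤ Δ → (d : ℝ) + 1 < θ q := by
      intro q hpq
      induction q, hpq using Nat.le_induction with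
      | base => exact fun _ => hp
      | succ q hpq ih =>
        intro hq
        have hq' : q < Δ := by omega
        have ihq := ih (by omega)
        have h1 := hlaw q hq' (range d) Subset.rfl
          (by rw [card_range]; linarith)
        rw [card_range] at h1
        have h2 : (d : ℝ) * κ q ≤ M := h1.trans (hpre d le_rfl)
        have h3 := he q hq'
        have h4 : (d : ℝ) * e ≤ M * θ (q + 1) :=
          calc (d : ℝ) * e ≤ d * (κ q * θ (q + 1)) := by gcongr
            _ = (d * κ q) * θ (q + 1) := by ring
            _ ≤ M * θ (q + 1) := mul_le_mul_of_nonneg_right h2 (hθ0 _).le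
        by_contra h5
        push Not at h5
        have h6 : M * θ (q + 1) ≤ M * (d + 1) := by gcongr
        have h7 : (d : ℝ) * (4 * M) < d * e := mul_lt_mul_of_pos_left heM hd0
        have h8 : M * 1 ≤ M * d := by gcongr
        nlinarith
    have := key Δ hpΔ le_rfl
    linarith
  -- Step C: the two-scale step `θ_{p+2} ≥ r θ_{p+1} θ_p`.
  have hC : ∀ p, p + 1 < Δ → r * θ (p + 1) * θ p ≤ θ (p + 2) := by
    intro p hp
    set T := θ (p + 1) with hT
    have hT4 : 4 * r ≤ T := hB p (by omega)
    have hT2 : 2 ≤ T := by linarith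
    have hT0 : 0 < T := by linarith
    have hTd : T ≤ d + 1 := hA (p + 1) (by omega)
    have hceil2 : 2 ≤ ⌈T⌉₊ := by
      have : 1 < ⌈T⌉₊ := Nat.lt_ceil.2 (by push_cast; linarith)
      omega
    have hceild : ⌈T⌉₊ ≤ d + 1 := Nat.ceil_le.2 (by push_cast; exact hTd)
    set n := ⌈T⌉₊ - 1 with hn
    have hn1 : 1 ≤ n := by omega
    have hnd : n ≤ d := by omega
    have hncast : (n : ℝ) = ⌈T⌉₊ - 1 := by rw [hn, Nat.cast_sub (by omega), Nat.cast_one]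
    have hnT : (n : ℝ) < T := by
      have h := Nat.ceil_lt_add_one hT0.le
      linarith
    have hTn : T ≤ 2 * n := by
      have h := Nat.le_ceil T
      linarith
    have hn0 : (0 : ℝ) < n := by exact_mod_cast hn1
    obtain ⟨W, hWd, hW1, hWn, hWsum⟩ := exists_light_window f hM hpre hn1 hnd
    have hWsum' : |∑ m ∈ W, f m| ≤ 4 * M / T := by
      refine hWsum.trans ?_
      rw [div_le_div_iff₀ hn0 hT0]
      nlinarith
    have hWcard : (W.card : ℝ) < T := lt_of_le_of_lt (by exact_mod_cast hWn) hnT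
    have hW1' : (1 : ℝ) ≤ W.card := by exact_mod_cast hW1
    have hlaw1 := hlaw (p + 1) hp W hWd hWcard
    by_cases hcase : (W.card : ℝ) < θ p
    · exfalso
      have hlaw0 := hlaw p (by omega) W hWd hcase
      have h2 := he p (by omega)
      have h3 : e * W.card ≤ 4 * M :=
        calc e * W.card ≤ κ p * T * W.card := by gcongr
          _ = (W.card * κ p) * T := by ring
          _ ≤ (4 * M / T) * T := mul_le_mul_of_nonneg_right (hlaw0.trans hWsum') hT0.le
          _ = 4 * M := by field_simp
      nlinarith
    · push Not at hcase
      have h2 := he (p + 1) hp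
      have hk : W.card * κ (p + 1) ≤ 4 * M / T := hlaw1.trans hWsum'
      have h3 : e * θ p ≤ 4 * M / T * θ (p + 2) :=
        calc e * θ p ≤ e * W.card := by gcongr
          _ ≤ κ (p + 1) * θ (p + 2) * W.card := by gcongr
          _ = (W.card * κ (p + 1)) * θ (p + 2) := by ring
          _ ≤ 4 * M / T * θ (p + 2) := mul_le_mul_of_nonneg_right hk (hθ0 _).le
      have h4 : e * θ p * T ≤ 4 * M * θ (p + 2) := by
        have := mul_le_mul_of_nonneg_right h3 hT0.le
        calc e * θ p * T ≤ 4 * M / T * θ (p + 2) * T := this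
          _ = 4 * M * θ (p + 2) := by field_simp
      calc r * T * θ p = (e * θ p * T) / (4 * M) := by rw [hr]; ring
        _ ≤ (4 * M * θ (p + 2)) / (4 * M) := by gcongr
        _ = θ (p + 2) := by field_simp
  -- Step D: Fibonacci growth of `u_p = r θ_p`.
  have hD : ∀ p, p + 1 ≤ Δ →
      (4 * r ^ 2) ^ Nat.fib p ≤ r * θ p ∧ (4 * r ^ 2) ^ Nat.fib (p + 1) ≤ r * θ (p + 1) := by
    intro p
    induction p with
    | zero =>
      intro hΔ'
      refine ⟨?_, ?_⟩
      · rw [Nat.fib_zero, pow_zero]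
        nlinarith [hθ1 0]
      · rw [Nat.fib_one, pow_one]
        have := hB 0 (by omega)
        nlinarith
    | succ p ih =>
      intro hp2
      obtain ⟨h0, h1⟩ := ih (by omega)
      refine ⟨h1, ?_⟩
      rw [show p + 1 + 1 = p + 2 from rfl, Nat.fib_add_two, pow_add]
      have hCp := hC p (by omega)
      have hrθ : 0 ≤ r * θ p := (mul_pos hr0 (hθ0 p)).le
      calc (4 * r ^ 2) ^ Nat.fib p * (4 * r ^ 2) ^ Nat.fib (p + 1)
          ≤ (r * θ p) * (r * θ (p + 1)) := by gcongr
        _ = r * (r * θ (p + 1) * θ p) := by ring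
        _ ≤ r * θ (p + 2) := by gcongr
  -- Step E: read off at level Δ.
  obtain ⟨_, hE⟩ := hD (Δ - 1) (by omega)
  rw [Nat.sub_add_cancel hΔ] at hE
  have hF : 1 ≤ Nat.fib Δ := Nat.fib_pos.2 (by omega)
  have h1 : (4 * r ^ 2) ^ Nat.fib Δ ≤ r * d := hE.trans (by gcongr)
  have h2 : (4 * r ^ 2) ^ Nat.fib Δ = (4 : ℝ) ^ Nat.fib Δ * r ^ (2 * Nat.fib Δ - 1) * r := by
    rw [mul_pow, ← pow_mul, mul_assoc, ← pow_succ,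
      show 2 * Nat.fib Δ - 1 + 1 = 2 * Nat.fib Δ by omega]
  rw [h2, mul_comm r (d : ℝ)] at h1
  exact le_of_mul_le_mul_right h1 hr0

/-- **Corollary: `4^{F_Δ} ≤ d`** under the hypotheses of `fib_cap`. -/
theorem four_pow_fib_le (f : ℕ → ℝ) {d Δ : ℕ} {M e : ℝ} {θ κ : ℕ → ℝ} (hM : 0 < M)
    (hpre : ∀ j, j ≤ d → |∑ m ∈ range j, f m| ≤ M)
    (hθ1 : ∀ p, 1 < θ p)
    (hlaw : ∀ p, p < Δ → ∀ W : Finset ℕ, W ⊆ range d → (W.card : ℝ) < θ p →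
      (W.card : ℝ) * κ p ≤ |∑ m ∈ W, f m|)
    (he : ∀ p, p < Δ → e ≤ κ p * θ (p + 1)) (heM : 4 * M < e) (hΔ : 1 ≤ Δ)
    (hfit : θ Δ ≤ d) : 4 ^ Nat.fib Δ ≤ d := by
  have h := fib_cap f hM hpre hθ1 hlaw he heM hΔ hfit
  have hr1 : 1 ≤ e / (4 * M) := by rw [le_div_iff₀ (by linarith)]; linarith
  have h' : (4 : ℝ) ^ Nat.fib Δ ≤ d :=
    calc (4 : ℝ) ^ Nat.fib Δ = 4 ^ Nat.fib Δ * 1 := (mul_one _).symm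
      _ ≤ 4 ^ Nat.fib Δ * (e / (4 * M)) ^ (2 * Nat.fib Δ - 1) := by
          gcongr
          exact one_le_pow₀ hr1
      _ ≤ d := h
  exact_mod_cast h'

/-- **The barrier form.**  In the regime `d < 4^{F_Δ}` (`Δ ≥ 1`), for every word with prefix sums in `[-M, M]`,
all thresholds `θ_p > 1` and all law constants with the fit `θ_Δ ≤ d`, SOME level certifies only
`κ_p θ_{p+1} ≤ 4M`. -/
theorem exists_weak_level (f : ℕ → ℝ) {d Δ : ℕ} {M : ℝ} {θ κ : ℕ → ℝ} (hM : 0 < M)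
    (hpre : ∀ j, j ≤ d → |∑ m ∈ range j, f m| ≤ M)
    (hθ1 : ∀ p, 1 < θ p)
    (hlaw : ∀ p, p < Δ → ∀ W : Finset ℕ, W ⊆ range d → (W.card : ℝ) < θ p →
      (W.card : ℝ) * κ p ≤ |∑ m ∈ W, f m|)
    (hΔ : 1 ≤ Δ) (hfit : θ Δ ≤ d) (hsmall : d < 4 ^ Nat.fib Δ) :
    ∃ p, p < Δ ∧ κ p * θ (p + 1) ≤ 4 * M := by
  by_contra hcon
  push Not at hcon
  have hne : (range Δ).Nonempty := nonempty_range_iff.2 (by omega)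
  obtain ⟨p₀, hp₀, hpe⟩ := exists_mem_eq_inf' hne (fun p => κ p * θ (p + 1))
  have he : ∀ p, p < Δ → (range Δ).inf' hne (fun p => κ p * θ (p + 1)) ≤ κ p * θ (p + 1) :=
    fun p hp => inf'_le _ (mem_range.2 hp)
  have heM : 4 * M < (range Δ).inf' hne (fun p => κ p * θ (p + 1)) := by
    rw [hpe]; exact hcon p₀ (mem_range.1 hp₀)
  have h := four_pow_fib_le f hM hpre hθ1 hlaw he heM hΔ hfit
  omega

/-- **The engine can only be run with `ε ≥ 2^{-2M}`** in the regime `d < 4^{F_Δ}`: the step hypothesis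
`2^{-κ_p θ_{p+1}/2} ≤ ε` of `Law.relRank_eval_le_law` at the weak level forces it. -/
theorem eps_ge (f : ℕ → ℝ) {d Δ : ℕ} {M ε : ℝ} {θ κ : ℕ → ℝ} (hM : 0 < M)
    (hpre : ∀ j, j ≤ d → |∑ m ∈ range j, f m| ≤ M)
    (hθ1 : ∀ p, 1 < θ p)
    (hlaw : ∀ p, p < Δ → ∀ W : Finset ℕ, W ⊆ range d → (W.card : ℝ) < θ p →
      (W.card : ℝ) * κ p ≤ |∑ m ∈ W, f m|)
    (hstep : ∀ p, p < Δ → (2 : ℝ) ^ (-κ p * θ (p + 1) / 2) ≤ ε)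
    (hΔ : 1 ≤ Δ) (hfit : θ Δ ≤ d) (hsmall : d < 4 ^ Nat.fib Δ) :
    (2 : ℝ) ^ (-(2 * M)) ≤ ε := by
  obtain ⟨p, hp, hle⟩ := exists_weak_level f hM hpre hθ1 hlaw hΔ hfit hsmall
  refine le_trans ?_ (hstep p hp)
  refine Real.rpow_le_rpow_of_exponent_le (by norm_num) ?_
  linarith

end Summit.ValiantsHypothesis.ValiantsHypothesis.Theorems.DepthWindow.LawCap
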